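import Summits.AnomalousDissipation.AnomalousDissipation.Theorems.MarginalStabilityChainChainRealisationStubPhaseOfCompactLimitsA
import HarnessLib

/-!
# Stub `stub_phaseOfCompactLimits` of the line `SketchIdeator2` (card `separatrix-flux-pinning`),
# helper file B: the NS phase carried by an abstract compact family of limit trajectories
# (crux `MarginalStabilityChain.ChainRealisation`, stmt-AnomalousDissipation-14249)

The soft (metric-space) half of the construction of an NS phase from compact limits of
time-translates.  Let `P` be a family of forward velocity fields on `[0,∞) × T³` ("limit
trajectories") such that

* every `v ∈ P` is the velocity of a classical solution of NS_ν forced by the steady `F` on `Ici 0`,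
  with mean-zero slices;
* `P` is invariant under forward time shifts `v ↦ v(· + τ)`, `τ ≥ 0`;
* two members of `P` with the same time-`0` slice agree at all `t ≥ 0` (forward uniqueness of
  classical solutions);
* COMPACTNESS: every sequence in `P` has a subsequence converging to a member of `P` in `L²` and
  `Ḣ¹`, uniformly on every `[0,T]`.

Then (`phaseCL_assemble`) the set `K ⊂ H` of classes of time-`0` slices of members of `P`, with the
semiflow `φ t x =` class of `v_x(t)` for a chosen `v_x ∈ P` through `x`, is an NS phase
(`IsNSPhase ν F K φ`) containing the forward trajectory of every `u ∈ P`: `K` is sequentially compact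
(`phaseCL_isCompact`), `φ` is well defined and a semiflow by uniqueness, and joint continuity of `φ`
on `Ici 0 × K` (`phaseCL_continuousOn`) and `L²`-continuity of the enstrophy on `K`
(`phaseCL_enstrophy_continuousOn`) follow from the sub-subsequence principle
(`Filter.tendsto_of_subseq_tendsto`) through the master lemma `phaseCL_master`: along `xₙ → x` in `K`
and `tₙ → t` in `[0,∞)` a subsequence of `v_{xₙ}(tₙ)` converges to `v_x(t)` in `L²` and `Ḣ¹`.

References: C. Foias, O. Manley, R. Rosa, R. Temam, *Navier–Stokes Equations and Turbulence*
(CUP 2001), Ch. III §2 (the semigroup on bounded absorbing sets), Ch. IV §1.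
-/

set_option linter.dupNamespace false

noncomputable section

open MeasureTheory Set Filter Topology
open scoped InnerProductSpace
open Literature.Analysis.FunctionSpaces Literature.Analysis.FunctionSpaces.Torus
open Literature.Analysis.FluidPDE

namespace Summit.AnomalousDissipation.AnomalousDissipation.Theorems.ChainRealisation.SeparatrixFluxPinning

open Summit.AnomalousDissipation.AnomalousDissipation.Theorems.DenseLoudDesignerForces.Ergodic
open Literature.Analysis.FluidPDE.Torus

/-! ## Convergence of states from `L²`-convergence of representatives -/

/-- States converge in `H` when representatives converge in `L²`. -/
theorem phaseCL_tendsto_of_conv {xs : ℕ → Hsp} {w : ℕ → UnitAddTorus (Fin 3) → EuclideanSpace ℝ (Fin 3)}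
    {z : Hsp} {w₀ : UnitAddTorus (Fin 3) → EuclideanSpace ℝ (Fin 3)}
    (hxs : ∀ n, rep (xs n) =ᵐ[volume] w n) (hz : rep z =ᵐ[volume] w₀)
    (hconv : ∀ ε, 0 < ε → ∀ᶠ n in atTop, (∫ y, ‖w n y - w₀ y‖ ^ 2) ≤ ε) :
    Tendsto xs atTop (𝓝 z) :=
  phaseCL_tendsto_of_norm_sub_sq fun ε hε => (hconv ε hε).mono fun n hn => by
    rwa [phaseCL_norm_sub_sq_eq (hxs n) hz]

/-! ## The master convergence lemma and compactness of `K` -/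

/-- **Master lemma.** For an abstract family `P` of forward fields with smooth solenoidal mean-zero
slices, jointly smooth on `[0,∞) × T³`, with forward uniqueness from the time-`0` slice and the
COMPACTNESS property, and for chosen members `traj x ∈ P` representing the points `x` of `K`: along
`xₙ → x` in `K` and `0 ≤ tₙ → t`, a subsequence of `traj xₙ (tₙ)` converges to `traj x t` in `L²`
and in `Ḣ¹` (extract a convergent subsequence of `traj xₙ`; its limit has the time-`0` slice of `x`,
hence is `traj x`; conclude with the uniform-on-`[0,t+1]` convergence and the time continuity of
`traj x`). -/
theorem phaseCL_master {P : (ℝ → UnitAddTorus (Fin 3) → EuclideanSpace ℝ (Fin 3)) → Prop}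
    (hPreg : ∀ v, P v → ∀ t : ℝ, 0 ≤ t → IsSmooth (v t) ∧ IsDivFree (v t) ∧ HasZeroMean (v t))
    (hPst : ∀ v, P v → IsSmoothSpaceTimeOn (Ici 0) v)
    (hPuniq : ∀ v w, P v → P w → v 0 = w 0 → ∀ t : ℝ, 0 ≤ t → v t = w t)
    (hPcomp : ∀ vs : ℕ → ℝ → UnitAddTorus (Fin 3) → EuclideanSpace ℝ (Fin 3), (∀ k, P (vs k)) →
      ∃ ψ : ℕ → ℕ, StrictMono ψ ∧ ∃ v, P v ∧ ∀ T ε : ℝ, 0 ≤ T → 0 < ε → ∀ᶠ n in atTop,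
        ∀ t ∈ Icc 0 T, (∫ x, ‖vs (ψ n) t x - v t x‖ ^ 2) ≤ ε ∧
          gradNormSq (fun x => vs (ψ n) t x - v t x) ≤ ε)
    {K : Set Hsp} {traj : Hsp → ℝ → UnitAddTorus (Fin 3) → EuclideanSpace ℝ (Fin 3)}
    (hKP : ∀ x ∈ K, P (traj x) ∧ rep x =ᵐ[volume] traj x 0)
    {xs : ℕ → Hsp} {x : Hsp} {ts : ℕ → ℝ} {t : ℝ}
    (hxs : ∀ n, xs n ∈ K) (hx : x ∈ K) (hts : ∀ n, 0 ≤ ts n) (ht : 0 ≤ t)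
    (hxl : Tendsto xs atTop (𝓝 x)) (htl : Tendsto ts atTop (𝓝 t)) :
    ∃ ψ : ℕ → ℕ, StrictMono ψ ∧ ∀ ε : ℝ, 0 < ε → ∀ᶠ n in atTop,
      (∫ y, ‖traj (xs (ψ n)) (ts (ψ n)) y - traj x t y‖ ^ 2) ≤ ε ∧
        gradNormSq (fun y => traj (xs (ψ n)) (ts (ψ n)) y - traj x t y) ≤ ε := by
  obtain ⟨ψ, hψ, v, hv, hconv⟩ := hPcomp (fun n => traj (xs n)) fun n => (hKP _ (hxs n)).1
  -- the limit has the time-`0` slice of `x`, hence is `traj x` on `[0,∞)`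
  have hv0r := hPreg v hv 0 le_rfl
  obtain ⟨z, hz⟩ := phaseCL_exists_rep_ae_eq hv0r.1 hv0r.2.1 hv0r.2.2
  have hz_lim : Tendsto (xs ∘ ψ) atTop (𝓝 z) :=
    phaseCL_tendsto_of_conv (fun n => (hKP _ (hxs (ψ n))).2) hz fun ε hε =>
      (hconv 0 ε le_rfl hε).mono fun n hn => (hn 0 ⟨le_rfl, le_rfl⟩).1
  have hzx : z = x := tendsto_nhds_unique hz_lim (hxl.comp hψ.tendsto_atTop)
  rw [hzx] at hz
  have hv0 : v 0 = traj x 0 :=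
    Measure.eq_of_ae_eq (hz.symm.trans (hKP x hx).2) hv0r.1.continuous
      (hPreg _ (hKP x hx).1 0 le_rfl).1.continuous
  have hvx : ∀ s : ℝ, 0 ≤ s → v s = traj x s := hPuniq v (traj x) hv (hKP x hx).1 hv0
  -- the estimate
  refine ⟨ψ, hψ, fun ε hε => ?_⟩
  have hε4 : 0 < ε / 4 := by positivity
  have htl' : Tendsto (ts ∘ ψ) atTop (𝓝 t) := htl.comp hψ.tendsto_atTop
  have hE1 := hconv (t + 1) (ε / 4) (by linarith) hε4
  have hE2 : ∀ᶠ n in atTop, ts (ψ n) ≤ t + 1 := htl'.eventually (Iic_mem_nhds (lt_add_one t))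
  have hE3 : ∀ᶠ n in atTop, (∫ y, ‖traj x (ts (ψ n)) y - traj x t y‖ ^ 2) ≤ ε / 4 ∧
      gradNormSq (fun y => traj x (ts (ψ n)) y - traj x t y) ≤ ε / 4 := by
    have hw : Tendsto (ts ∘ ψ) atTop (𝓝[Ici 0] t) :=
      tendsto_nhdsWithin_iff.2 ⟨htl', Eventually.of_forall fun n => mem_Ici.2 (hts _)⟩
    exact hw.eventually (phaseCL_time_continuity _ _ _ (hPst _ (hKP x hx).1) ht hε4)
  filter_upwards [hE1, hE2, hE3] with n h1 h2 h3
  have hs0 : 0 ≤ ts (ψ n) := hts _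
  have h1s := h1 (ts (ψ n)) ⟨hs0, h2⟩
  rw [hvx _ hs0] at h1s
  have hsa : IsSmooth (traj (xs (ψ n)) (ts (ψ n))) := (hPreg _ (hKP _ (hxs (ψ n))).1 _ hs0).1
  have hsb : IsSmooth (traj x (ts (ψ n))) := (hPreg _ (hKP x hx).1 _ hs0).1
  have hsc : IsSmooth (traj x t) := (hPreg _ (hKP x hx).1 t ht).1
  constructor
  · have h4 := phaseCL_integral_tri hsa.continuous hsb.continuous hsc.continuous
    linarith [h1s.1, h3.1]
  · have h4 := phaseCL_gradNormSq_tri hsa hsb hsc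
    linarith [h1s.2, h3.2]

/-- **`K` is compact**: a sequence of points of `K` is represented by the time-`0` slices of members
of `P`; a convergent subsequence of those (COMPACTNESS) converges at time `0` in `L²`, i.e. the
points converge in `H` to the class of the limit's time-`0` slice, a point of `K`
(`IsSeqCompact.isCompact` in the metric space `H`). -/
theorem phaseCL_isCompact {P : (ℝ → UnitAddTorus (Fin 3) → EuclideanSpace ℝ (Fin 3)) → Prop}
    (hPreg : ∀ v, P v → ∀ t : ℝ, 0 ≤ t → IsSmooth (v t) ∧ IsDivFree (v t) ∧ HasZeroMean (v t))
    (hPcomp : ∀ vs : ℕ → ℝ → UnitAddTorus (Fin 3) → EuclideanSpace ℝ (Fin 3), (∀ k, P (vs k)) →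
      ∃ ψ : ℕ → ℕ, StrictMono ψ ∧ ∃ v, P v ∧ ∀ T ε : ℝ, 0 ≤ T → 0 < ε → ∀ᶠ n in atTop,
        ∀ t ∈ Icc 0 T, (∫ x, ‖vs (ψ n) t x - v t x‖ ^ 2) ≤ ε ∧
          gradNormSq (fun x => vs (ψ n) t x - v t x) ≤ ε)
    {K : Set Hsp} {traj : Hsp → ℝ → UnitAddTorus (Fin 3) → EuclideanSpace ℝ (Fin 3)}
    (hKP : ∀ x ∈ K, P (traj x) ∧ rep x =ᵐ[volume] traj x 0)
    (hKof : ∀ x : Hsp, (∃ v, P v ∧ rep x =ᵐ[volume] v 0) → x ∈ K) : IsCompact K := by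
  refine IsSeqCompact.isCompact fun xs hxs => ?_
  obtain ⟨ψ, hψ, v, hv, hconv⟩ := hPcomp (fun n => traj (xs n)) fun n => (hKP _ (hxs n)).1
  have hv0r := hPreg v hv 0 le_rfl
  obtain ⟨z, hz⟩ := phaseCL_exists_rep_ae_eq hv0r.1 hv0r.2.1 hv0r.2.2
  exact ⟨z, hKof z ⟨v, hv, hz⟩, ψ, hψ,
    phaseCL_tendsto_of_conv (fun n => (hKP _ (hxs (ψ n))).2) hz fun ε hε =>
      (hconv 0 ε le_rfl hε).mono fun n hn => (hn 0 ⟨le_rfl, le_rfl⟩).1⟩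

/-! ## Joint continuity of the semiflow and continuity of the enstrophy -/

/-- **Joint continuity of `φ t x = [traj x t]` on `Ici 0 × K`** (sequential, by the sub-subsequence
principle and the master lemma; the `H`-distance of classes is the `L²`-distance of the smooth
representatives). -/
theorem phaseCL_continuousOn {P : (ℝ → UnitAddTorus (Fin 3) → EuclideanSpace ℝ (Fin 3)) → Prop}
    (hPreg : ∀ v, P v → ∀ t : ℝ, 0 ≤ t → IsSmooth (v t) ∧ IsDivFree (v t) ∧ HasZeroMean (v t))
    (hPst : ∀ v, P v → IsSmoothSpaceTimeOn (Ici 0) v)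
    (hPuniq : ∀ v w, P v → P w → v 0 = w 0 → ∀ t : ℝ, 0 ≤ t → v t = w t)
    (hPcomp : ∀ vs : ℕ → ℝ → UnitAddTorus (Fin 3) → EuclideanSpace ℝ (Fin 3), (∀ k, P (vs k)) →
      ∃ ψ : ℕ → ℕ, StrictMono ψ ∧ ∃ v, P v ∧ ∀ T ε : ℝ, 0 ≤ T → 0 < ε → ∀ᶠ n in atTop,
        ∀ t ∈ Icc 0 T, (∫ x, ‖vs (ψ n) t x - v t x‖ ^ 2) ≤ ε ∧
          gradNormSq (fun x => vs (ψ n) t x - v t x) ≤ ε)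
    {K : Set Hsp} {traj : Hsp → ℝ → UnitAddTorus (Fin 3) → EuclideanSpace ℝ (Fin 3)}
    (hKP : ∀ x ∈ K, P (traj x) ∧ rep x =ᵐ[volume] traj x 0)
    {toH : (UnitAddTorus (Fin 3) → EuclideanSpace ℝ (Fin 3)) → Hsp}
    (htoH : ∀ w, IsSmooth w → IsDivFree w → HasZeroMean w → rep (toH w) =ᵐ[volume] w)
    {φ : ℝ → Hsp → Hsp} (hφ : ∀ t x, φ t x = toH (traj x t)) :
    ContinuousOn (fun q : ℝ × Hsp => φ q.1 q.2) (Ici 0 ×ˢ K) := by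
  classical
  rintro ⟨t, x⟩ ⟨ht, hx⟩
  replace ht : 0 ≤ t := ht
  show Tendsto (fun q : ℝ × Hsp => φ q.1 q.2) (𝓝[Ici 0 ×ˢ K] (t, x)) (𝓝 (φ t x))
  apply tendsto_of_subseq_tendsto
  intro ns hns
  have h1 : Tendsto ns atTop (𝓝 (t, x)) := tendsto_nhds_of_tendsto_nhdsWithin hns
  have h2 : ∀ᶠ n in atTop, ns n ∈ Ici (0 : ℝ) ×ˢ K :=
    eventually_mem_of_tendsto_nhdsWithin hns
  set xs : ℕ → Hsp := fun n => if (ns n).2 ∈ K then (ns n).2 else x with hxs_def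
  set ts : ℕ → ℝ := fun n => max (ns n).1 0 with hts_def
  have hxsK : ∀ n, xs n ∈ K := fun n => by
    simp only [hxs_def]
    split_ifs with h
    · exact h
    · exact hx
  have hts0 : ∀ n, 0 ≤ ts n := fun n => le_max_right _ _
  have hev : ∀ᶠ n in atTop, xs n = (ns n).2 ∧ ts n = (ns n).1 :=
    h2.mono fun n hn => ⟨if_pos hn.2, max_eq_left hn.1⟩
  have hxl : Tendsto xs atTop (𝓝 x) :=
    ((continuous_snd.tendsto _).comp h1).congr' (hev.mono fun n hn => hn.1.symm)
  have htl : Tendsto ts atTop (𝓝 t) :=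
    ((continuous_fst.tendsto _).comp h1).congr' (hev.mono fun n hn => hn.2.symm)
  obtain ⟨ψ, hψ, hconv⟩ := phaseCL_master hPreg hPst hPuniq hPcomp hKP hxsK hx hts0 ht hxl htl
  refine ⟨ψ, ?_⟩
  show Tendsto (fun n => φ (ns (ψ n)).1 (ns (ψ n)).2) atTop (𝓝 (φ t x))
  have hev' :
      (fun n => φ (ts (ψ n)) (xs (ψ n))) =ᶠ[atTop] fun n => φ (ns (ψ n)).1 (ns (ψ n)).2 :=
    (hψ.tendsto_atTop.eventually hev).mono fun n hn => by
      show φ (ts (ψ n)) (xs (ψ n)) = φ (ns (ψ n)).1 (ns (ψ n)).2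
      rw [hn.1, hn.2]
  refine Tendsto.congr' hev' (phaseCL_tendsto_of_norm_sub_sq fun ε hε => ?_)
  filter_upwards [hconv ε hε] with n hn
  have hr1 := hPreg _ (hKP _ (hxsK (ψ n))).1 (ts (ψ n)) (hts0 _)
  have hr2 := hPreg _ (hKP x hx).1 t ht
  rw [hφ, hφ,
    phaseCL_norm_sub_sq_eq (htoH _ hr1.1 hr1.2.1 hr1.2.2) (htoH _ hr2.1 hr2.2.1 hr2.2.2)]
  exact hn.1

/-- **`L²`-continuity of the enstrophy on `K`** (sequential, by the sub-subsequence principle, the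
master lemma at `t = 0`, and the `Ḣ¹`-continuity of `‖∇·‖₂²` along smooth sequences). -/
theorem phaseCL_enstrophy_continuousOn {P : (ℝ → UnitAddTorus (Fin 3) → EuclideanSpace ℝ (Fin 3)) → Prop}
    (hPreg : ∀ v, P v → ∀ t : ℝ, 0 ≤ t → IsSmooth (v t) ∧ IsDivFree (v t) ∧ HasZeroMean (v t))
    (hPst : ∀ v, P v → IsSmoothSpaceTimeOn (Ici 0) v)
    (hPuniq : ∀ v w, P v → P w → v 0 = w 0 → ∀ t : ℝ, 0 ≤ t → v t = w t)
    (hPcomp : ∀ vs : ℕ → ℝ → UnitAddTorus (Fin 3) → EuclideanSpace ℝ (Fin 3), (∀ k, P (vs k)) →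
      ∃ ψ : ℕ → ℕ, StrictMono ψ ∧ ∃ v, P v ∧ ∀ T ε : ℝ, 0 ≤ T → 0 < ε → ∀ᶠ n in atTop,
        ∀ t ∈ Icc 0 T, (∫ x, ‖vs (ψ n) t x - v t x‖ ^ 2) ≤ ε ∧
          gradNormSq (fun x => vs (ψ n) t x - v t x) ≤ ε)
    {K : Set Hsp} {traj : Hsp → ℝ → UnitAddTorus (Fin 3) → EuclideanSpace ℝ (Fin 3)}
    (hKP : ∀ x ∈ K, P (traj x) ∧ rep x =ᵐ[volume] traj x 0) :
    ContinuousOn enstrophyObs K := by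
  classical
  intro x hx
  show Tendsto enstrophyObs (𝓝[K] x) (𝓝 (enstrophyObs x))
  apply tendsto_of_subseq_tendsto
  intro ns hns
  have h1 : Tendsto ns atTop (𝓝 x) := tendsto_nhds_of_tendsto_nhdsWithin hns
  have h2 : ∀ᶠ n in atTop, ns n ∈ K := eventually_mem_of_tendsto_nhdsWithin hns
  set xs : ℕ → Hsp := fun n => if ns n ∈ K then ns n else x with hxs_def
  have hxsK : ∀ n, xs n ∈ K := fun n => by
    simp only [hxs_def]
    split_ifs with h
    · exact h
    · exact hx
  have hev : ∀ᶠ n in atTop, xs n = ns n := h2.mono fun n hn => if_pos hn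
  have hxl : Tendsto xs atTop (𝓝 x) := h1.congr' (hev.mono fun n hn => hn.symm)
  obtain ⟨ψ, hψ, hconv⟩ := phaseCL_master hPreg hPst hPuniq hPcomp hKP hxsK hx
    (ts := fun _ => 0) (fun _ => le_rfl) le_rfl hxl tendsto_const_nhds
  refine ⟨ψ, ?_⟩
  show Tendsto (fun n => enstrophyObs (ns (ψ n))) atTop (𝓝 (enstrophyObs x))
  have hev' : (fun n => enstrophyObs (xs (ψ n))) =ᶠ[atTop] fun n => enstrophyObs (ns (ψ n)) :=
    (hψ.tendsto_atTop.eventually hev).mono fun n hn => by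
      show enstrophyObs (xs (ψ n)) = enstrophyObs (ns (ψ n))
      rw [hn]
  refine Tendsto.congr' hev' ?_
  have hgx := (hPreg _ (hKP x hx).1 0 le_rfl).1
  have hgn : ∀ n, IsSmooth (traj (xs (ψ n)) 0) := fun n =>
    (hPreg _ (hKP _ (hxsK (ψ n))).1 0 le_rfl).1
  have heq : (fun n => enstrophyObs (xs (ψ n))) = fun n => gradNormSq (traj (xs (ψ n)) 0) :=
    funext fun n => phaseCL_enstrophyObs_eq (hKP _ (hxsK (ψ n))).2 (hgn n)
  rw [phaseCL_enstrophyObs_eq (hKP x hx).2 hgx, heq]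
  exact phaseCL_tendsto_gradNormSq hgn hgx fun ε hε => (hconv ε hε).mono fun n hn => hn.2

/-! ## Assembly of the phase -/

/-- **The NS phase carried by an abstract compact family of limit trajectories.** Let `P` be a
shift-invariant family of velocities of classical solutions of NS_ν (steady force `F`) on `[0,∞) × T³`
with mean-zero slices, with forward uniqueness from the time-`0` slice and the COMPACTNESS property.
Then `K = {[v 0] : v ∈ P} ⊂ H` with `φ t x = [v_x t]` (`v_x ∈ P` a chosen member through `x`) is an
NS phase, and the forward trajectory of every `u ∈ P` is the phase orbit of `[u 0] ∈ K`. -/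
theorem phaseCL_assemble :
    ∀ (ν : ℝ) (F : UnitAddTorus (Fin 3) → EuclideanSpace ℝ (Fin 3))
      (P : (ℝ → UnitAddTorus (Fin 3) → EuclideanSpace ℝ (Fin 3)) → Prop)
      (u : ℝ → UnitAddTorus (Fin 3) → EuclideanSpace ℝ (Fin 3)),
      (∀ v, P v → ∃ q : ℝ → UnitAddTorus (Fin 3) → ℝ,
        IsClassicalNSSolutionOn (Set.Ici 0) ν (fun _ => F) v q) →
      (∀ v, P v → ∀ t : ℝ, 0 ≤ t → HasZeroMean (v t)) →
      (∀ v, P v → ∀ τ : ℝ, 0 ≤ τ → P (fun t => v (t + τ))) →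
      (∀ v w, P v → P w → v 0 = w 0 → ∀ t : ℝ, 0 ≤ t → v t = w t) →
      (∀ vs : ℕ → ℝ → UnitAddTorus (Fin 3) → EuclideanSpace ℝ (Fin 3), (∀ k, P (vs k)) →
        ∃ ψ : ℕ → ℕ, StrictMono ψ ∧ ∃ v, P v ∧ ∀ T ε : ℝ, 0 ≤ T → 0 < ε → ∀ᶠ n in atTop,
          ∀ t ∈ Set.Icc 0 T, (∫ x, ‖vs (ψ n) t x - v t x‖ ^ 2) ≤ ε ∧
            gradNormSq (fun x => vs (ψ n) t x - v t x) ≤ ε) →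
      P u →
      ∃ (K : Set Hsp) (φ : ℝ → Hsp → Hsp) (x₀ : Hsp), IsNSPhase ν F K φ ∧ x₀ ∈ K ∧
        ∀ t : ℝ, 0 ≤ t → rep (φ t x₀) =ᵐ[volume] u t := by
  intro ν F P u hPcl hPmz hPshift hPuniq hPcomp hu
  -- regularity of the members of `P`
  have hPst : ∀ v, P v → IsSmoothSpaceTimeOn (Ici 0) v := fun v hv => by
    obtain ⟨q, hq⟩ := hPcl v hv
    exact hq.smooth_velocity
  have hPreg : ∀ v, P v → ∀ t : ℝ, 0 ≤ t →
      IsSmooth (v t) ∧ IsDivFree (v t) ∧ HasZeroMean (v t) := by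
    intro v hv t ht
    obtain ⟨q, hq⟩ := hPcl v hv
    exact ⟨hq.smooth_velocity.isSmooth_slice (mem_Ici.2 ht), hq.divFree t (mem_Ici.2 ht),
      hPmz v hv t ht⟩
  -- the class map, the set `K`, the chosen trajectories, the semiflow
  obtain ⟨toH, htoH⟩ : ∃ toH : (UnitAddTorus (Fin 3) → EuclideanSpace ℝ (Fin 3)) → Hsp,
      ∀ w, IsSmooth w → IsDivFree w → HasZeroMean w → rep (toH w) =ᵐ[volume] w :=
    ⟨fun w => Classical.epsilon fun x : Hsp => rep x =ᵐ[volume] w,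
      fun w hw hdiv hmz => Classical.epsilon_spec (phaseCL_exists_rep_ae_eq hw hdiv hmz)⟩
  obtain ⟨K, hK⟩ : ∃ K : Set Hsp, ∀ x, x ∈ K ↔ ∃ v, P v ∧ rep x =ᵐ[volume] v 0 :=
    ⟨{x | ∃ v, P v ∧ rep x =ᵐ[volume] v 0}, fun _ => Iff.rfl⟩
  obtain ⟨traj, htraj⟩ : ∃ traj : Hsp → ℝ → UnitAddTorus (Fin 3) → EuclideanSpace ℝ (Fin 3),
      ∀ x : Hsp, (∃ v, P v ∧ rep x =ᵐ[volume] v 0) → P (traj x) ∧ rep x =ᵐ[volume] traj x 0 :=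
    ⟨fun x => Classical.epsilon fun v => P v ∧ rep x =ᵐ[volume] v 0,
      fun x hx => Classical.epsilon_spec hx⟩
  have hKP : ∀ x ∈ K, P (traj x) ∧ rep x =ᵐ[volume] traj x 0 := fun x hx =>
    htraj x ((hK x).1 hx)
  have hKof : ∀ x : Hsp, (∃ v, P v ∧ rep x =ᵐ[volume] v 0) → x ∈ K := fun x hx =>
    (hK x).2 hx
  obtain ⟨φ, hφ⟩ : ∃ φ : ℝ → Hsp → Hsp, ∀ t x, φ t x = toH (traj x t) :=
    ⟨fun t x => toH (traj x t), fun _ _ => rfl⟩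
  have hφrep : ∀ x ∈ K, ∀ t : ℝ, 0 ≤ t → rep (φ t x) =ᵐ[volume] traj x t := by
    intro x hx t ht
    have hr := hPreg _ (hKP x hx).1 t ht
    rw [hφ]
    exact htoH _ hr.1 hr.2.1 hr.2.2
  -- identification of members of `P` through the same state
  have hident :
      ∀ x ∈ K, ∀ v, P v → rep x =ᵐ[volume] v 0 → ∀ t : ℝ, 0 ≤ t → traj x t = v t := by
    intro x hx v hv hxv t ht
    refine hPuniq (traj x) v (hKP x hx).1 hv ?_ t ht
    exact Measure.eq_of_ae_eq ((hKP x hx).2.symm.trans hxv)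
      (hPreg _ (hKP x hx).1 0 le_rfl).1.continuous (hPreg v hv 0 le_rfl).1.continuous
  -- forward invariance
  have hmaps : ∀ t : ℝ, 0 ≤ t → ∀ x ∈ K, φ t x ∈ K := by
    intro t ht x hx
    refine hKof _ ⟨fun s => traj x (s + t), hPshift _ (hKP x hx).1 t ht, ?_⟩
    simpa only [zero_add] using hφrep x hx t ht
  -- the base point
  have hu0 := hPreg u hu 0 le_rfl
  have hx₀K : toH (u 0) ∈ K := hKof _ ⟨u, hu, htoH _ hu0.1 hu0.2.1 hu0.2.2⟩
  refine ⟨K, φ, toH (u 0), ⟨?_, fun t ht x hx => hmaps t ht x hx, ?_, ?_, ?_, ?_, ?_, ?_⟩, hx₀K,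
    fun t ht => ?_⟩
  · exact phaseCL_isCompact hPreg hPcomp hKP hKof
  · intro x hx
    exact phaseCL_eq_of_rep_ae_eq ((hφrep x hx 0 le_rfl).trans (hKP x hx).2.symm)
  · intro s t hs ht x hx
    have hy : φ t x ∈ K := hmaps t ht x hx
    have hyv : rep (φ t x) =ᵐ[volume] (fun r => traj x (r + t)) 0 := by
      simpa only [zero_add] using hφrep x hx t ht
    have h := hident (φ t x) hy (fun r => traj x (r + t)) (hPshift _ (hKP x hx).1 t ht) hyv s hs
    rw [hφ (s + t) x, hφ s (φ t x), h]
  · exact phaseCL_continuousOn hPreg hPst hPuniq hPcomp hKP htoH hφ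
  · intro x hx
    exact phaseCL_eGradNormSq_rep_ne_top (hKP x hx).2 (hPreg _ (hKP x hx).1 0 le_rfl).1
  · exact phaseCL_enstrophy_continuousOn hPreg hPst hPuniq hPcomp hKP
  · intro x hx
    obtain ⟨q, hq⟩ := hPcl _ (hKP x hx).1
    exact ⟨traj x, q, hq, fun t ht => hφrep x hx t ht⟩
  · rw [← hident _ hx₀K u hu (htoH _ hu0.1 hu0.2.1 hu0.2.2) t ht]
    exact hφrep _ hx₀K t ht

end Summit.AnomalousDissipation.AnomalousDissipation.Theorems.ChainRealisation.SeparatrixFluxPinning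

end
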